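import Mathlib
import HarnessLib
import Summits.QuantumFields.YangMills.Theses.CertificationLength
import Summits.QuantumFields.YangMills.Theorems.PencilRigidityCurvatureKernelBoundSplit

/-! Strategist s1 (gen 1) — BY-NAME READBACK of split D1 against route CertificationLength: the three children rendered
exactly as the gate renders route items (route namespace, route opens), and the landed glue
`Summit.QuantumFields.YangMills.Theorems.CurvatureKernel.CurvatureKernelBound_of_subs` (p137385) applied BY NAME to conclude
`CertificationLength.CurvatureKernelBound`. rc 0 ⇒ `route edit route-QuantumFields-CertificationLength --split CurvatureKernelBound
--glue-by …CurvatureKernelBound_of_subs` elaborates. -/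

namespace Summit.QuantumFields.YangMills.Theses.CertificationLength

open scoped BigOperators Topology Manifold Classical MeasureTheory ProbabilityTheory Matrix InnerProductSpace ComplexConjugate ContinuousMap
open Filter Set Function TopologicalSpace MeasureTheory

/-- split child 1 (readback copy) -/
def CurvatureKernelBoundWeakCoupling : Prop :=
  open Literature.MathematicalPhysics.QuantumLattice Literature.MathematicalPhysics.AQFT Literature.MathematicalPhysics.QuantumFieldTheory in let E := EuclideanSpace ℝ (Fin 4); ∀ (G : Type) [Group G] [TopologicalSpace G] [IsTopologicalGroup G] [CompactSpace G], IsCompactSimpleLieGroup G → letI : MeasurableSpace G := borel G; haveI : BorelSpace G := ⟨rfl⟩; let W₁ := fun (r : LatticeRep G) (sch : SpeciesScheme (YMSpecies G)) (S₁ : SchwingerFamily E) => ((∀ (n : ℕ), n ≠ 0 → ∀ (f : Fin n → SchwartzMap (E) ℝ) (F : SchwartzMap (Fin n → E) ℂ), IsTensorOf F (fun i => ofRealTest (f i)) → IsOffDiagonal F → Filter.Tendsto (fun k : ℕ => ((latticeSchwinger r.ρ sch (fun s => s.F) k n (fun _ => r.curvature) f : ℝ) : ℂ)) Filter.atTop (nhds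 (S₁ n F))) ∧ (S₁.toLabelled.IsNormalized ∧ S₁.toLabelled.IsHermitian ∧ S₁.toLabelled.HasLinearGrowth ∧ S₁.toLabelled.IsReflectionPositive ∧ S₁.toLabelled.IsSymmetric ∧ S₁.toLabelled.HasClusterProperty) ∧ (∀ (n : ℕ) (a : E) (F : SchwartzMap (Fin n → E) ℂ), IsOffDiagonal F → S₁ n (translateMulti a F) = S₁ n F) ∧ (∀ (R : E ≃ₗᵢ[ℝ] E), LinearMap.det (R.toLinearEquiv : E →ₗ[ℝ] E) = 1 → (∀ i : Fin 4, ∃ j : Fin 4, R (EuclideanSpace.single i 1) = EuclideanSpace.single j 1 ∨ R (EuclideanSpace.single i 1) = -EuclideanSpace.single j 1) → ∀ (n : ℕ) (F : SchwartzMap (Fin n → E) ℂ), IsOffDiagonal F → S₁ n (linActMulti R F) = S₁ n F) ∧ (∃ Δ : ℝ, 0 < Δ ∧ S₁.toLabelled.HasMassGap Δ ∧ HasLatticeMassGap r sch Δ)); ∀ (r : LatticeRep G) (sch : SpeciesScheme (YMSpecies G)) (S₁ : SchwingerFamily E), W₁ r sch S₁ → sch.HasWeakCouplingLimit → ∃ (K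 : E → ℝ) (C η : ℝ), 0 < η ∧ ContinuousOn K {x : E | x ≠ 0} ∧ (∀ x : E, x ≠ 0 → |K x| ≤ C * (1 + ‖x‖ ^ (η - 10))) ∧ ∀ F : SchwartzMap (Fin 2 → E) ℂ, IsOffDiagonal F → MeasureTheory.Integrable (fun x : Fin 2 → E => (K (x 0 - x 1) : ℂ) * F x) ∧ S₁ 2 F = ∫ x : Fin 2 → E, (K (x 0 - x 1) : ℂ) * F x

/-- split child 2 (readback copy) -/
def CurvatureKernelBoundFiniteCoupling : Prop :=
  open Literature.MathematicalPhysics.QuantumLattice Literature.MathematicalPhysics.AQFT Literature.MathematicalPhysics.QuantumFieldTheory in let E := EuclideanSpace ℝ (Fin 4); ∀ (G : Type) [Group G] [TopologicalSpace G] [IsTopologicalGroup G] [CompactSpace G], IsCompactSimpleLieGroup G → letI : MeasurableSpace G := borel G; haveI : BorelSpace G := ⟨rfl⟩; let W₁ := fun (r : LatticeRep G) (sch : SpeciesScheme (YMSpecies G)) (S₁ : SchwingerFamily E) => ((∀ (n : ℕ), n ≠ 0 → ∀ (f : Fin n → SchwartzMap (E) ℝ) (F : SchwartzMap (Fin n →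 E) ℂ), IsTensorOf F (fun i => ofRealTest (f i)) → IsOffDiagonal F → Filter.Tendsto (fun k : ℕ => ((latticeSchwinger r.ρ sch (fun s => s.F) k n (fun _ => r.curvature) f : ℝ) : ℂ)) Filter.atTop (nhds (S₁ n F))) ∧ (S₁.toLabelled.IsNormalized ∧ S₁.toLabelled.IsHermitian ∧ S₁.toLabelled.HasLinearGrowth ∧ S₁.toLabelled.IsReflectionPositive ∧ S₁.toLabelled.IsSymmetric ∧ S₁.toLabelled.HasClusterProperty) ∧ (∀ (n : ℕ) (a : E) (F : SchwartzMap (Fin n → E) ℂ), IsOffDiagonal F → S₁ n (translateMulti a F) = S₁ n F) ∧ (∀ (R : E ≃ₗᵢ[ℝ] E), LinearMap.det (R.toLinearEquiv : E →ₗ[ℝ] E) = 1 → (∀ i : Fin 4, ∃ j : Fin 4, R (EuclideanSpace.single i 1) = EuclideanSpace.single j 1 ∨ R (EuclideanSpace.single i 1) = -EuclideanSpace.single j 1) → ∀ (n : ℕ) (F : SchwartzMap (Fin n → E) ℂ), IsOffDiagonal F → S₁ n (linActMulti R F) = S₁ n F) ∧ (∃ Δ : ℝ, 0 < Δ ∧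 S₁.toLabelled.HasMassGap Δ ∧ HasLatticeMassGap r sch Δ)); ∀ (r : LatticeRep G) (sch : SpeciesScheme (YMSpecies G)) (S₁ : SchwingerFamily E), W₁ r sch S₁ → (∃ b : ℝ, Filter.Tendsto sch.β Filter.atTop (nhds b)) → ∃ (K : E → ℝ) (C η : ℝ), 0 < η ∧ ContinuousOn K {x : E | x ≠ 0} ∧ (∀ x : E, x ≠ 0 → |K x| ≤ C * (1 + ‖x‖ ^ (η - 10))) ∧ ∀ F : SchwartzMap (Fin 2 → E) ℂ, IsOffDiagonal F → MeasureTheory.Integrable (fun x : Fin 2 → E => (K (x 0 - x 1) : ℂ) * F x) ∧ S₁ 2 F = ∫ x : Fin 2 → E, (K (x 0 - x 1) : ℂ) * F x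

/-- split child 3 (readback copy) -/
def CurvatureKernelBoundNegativeCoupling : Prop :=
  open Literature.MathematicalPhysics.QuantumLattice Literature.MathematicalPhysics.AQFT Literature.MathematicalPhysics.QuantumFieldTheory in let E := EuclideanSpace ℝ (Fin 4); ∀ (G : Type) [Group G] [TopologicalSpace G] [IsTopologicalGroup G] [CompactSpace G], IsCompactSimpleLieGroup G → letI : MeasurableSpace G := borel G; haveI : BorelSpace G := ⟨rfl⟩; let W₁ := fun (r : LatticeRep G) (sch : SpeciesScheme (YMSpecies G)) (S₁ : SchwingerFamily E) => ((∀ (n : ℕ), n ≠ 0 → ∀ (f : Fin n → SchwartzMap (E) ℝ) (F : SchwartzMap (Fin n → E) ℂ), IsTensorOf F (fun i => ofRealTest (f i)) → IsOffDiagonal F → Filter.Tendsto (fun k : ℕ => ((latticeSchwinger r.ρ sch (fun s => s.F) k n (fun _ => r.curvature) f : ℝ) : ℂ)) Filter.atTop (nhds (S₁ n F))) ∧ (S₁.toLabelled.IsNormalized ∧ S₁.toLabelled.IsHermitian ∧ S₁.toLabelled.HasLinearGrowth ∧ S₁.toLabelled.IsReflectionPositive ∧ S₁.toLabelled.IsSymmetric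 ∧ S₁.toLabelled.HasClusterProperty) ∧ (∀ (n : ℕ) (a : E) (F : SchwartzMap (Fin n → E) ℂ), IsOffDiagonal F → S₁ n (translateMulti a F) = S₁ n F) ∧ (∀ (R : E ≃ₗᵢ[ℝ] E), LinearMap.det (R.toLinearEquiv : E →ₗ[ℝ] E) = 1 → (∀ i : Fin 4, ∃ j : Fin 4, R (EuclideanSpace.single i 1) = EuclideanSpace.single j 1 ∨ R (EuclideanSpace.single i 1) = -EuclideanSpace.single j 1) → ∀ (n : ℕ) (F : SchwartzMap (Fin n → E) ℂ), IsOffDiagonal F → S₁ n (linActMulti R F) = S₁ n F) ∧ (∃ Δ : ℝ, 0 < Δ ∧ S₁.toLabelled.HasMassGap Δ ∧ HasLatticeMassGap r sch Δ)); ∀ (r : LatticeRep G) (sch : SpeciesScheme (YMSpecies G)) (S₁ : SchwingerFamily E), W₁ r sch S₁ → Filter.Tendsto sch.β Filter.atTop Filter.atBot → ∃ (K : E → ℝ) (C η : ℝ), 0 < η ∧ ContinuousOn K {x : E | x ≠ 0} ∧ (∀ x : E, x ≠ 0 → |K x| ≤ C * (1 + ‖x‖ ^ (η - 10))) ∧ ∀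 F : SchwartzMap (Fin 2 → E) ℂ, IsOffDiagonal F → MeasureTheory.Integrable (fun x : Fin 2 → E => (K (x 0 - x 1) : ℂ) * F x) ∧ S₁ 2 F = ∫ x : Fin 2 → E, (K (x 0 - x 1) : ℂ) * F x

/-- The landed glue concludes THIS route's rendering of the shared crux, by name. -/
theorem readback : CurvatureKernelBoundWeakCoupling → CurvatureKernelBoundFiniteCoupling →
    CurvatureKernelBoundNegativeCoupling → CurvatureKernelBound :=
  Summit.QuantumFields.YangMills.Theorems.CurvatureKernel.CurvatureKernelBound_of_subs

/-- Each child is weaker than the parent (one extra hypothesis). -/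
theorem children_of_parent (h : CurvatureKernelBound) :
    CurvatureKernelBoundWeakCoupling ∧ CurvatureKernelBoundFiniteCoupling ∧ CurvatureKernelBoundNegativeCoupling :=
  ⟨fun G _ _ _ _ hG r sch S₁ hW _ => h G hG r sch S₁ hW,
   fun G _ _ _ _ hG r sch S₁ hW _ => h G hG r sch S₁ hW,
   fun G _ _ _ _ hG r sch S₁ hW _ => h G hG r sch S₁ hW⟩

/-- The shared crux is ONE statement: CertificationLength's rendering is PencilRigidity's, definitionally. -/
theorem shared_iff : CurvatureKernelBound ↔ Summit.QuantumFields.YangMills.Theses.PencilRigidity.CurvatureKernelBound := Iff.rfl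

end Summit.QuantumFields.YangMills.Theses.CertificationLength
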